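import Literature.MathematicalPhysics.QuantumFieldTheory.Balaban1983to89.B9Eq344HessianRowDecomposition
import Literature.MathematicalPhysics.QuantumFieldTheory.Balaban1983to89.B9Eq3117CommutatorBound
import Literature.MathematicalPhysics.QuantumFieldTheory.Balaban1983to89.B9Eq34CovCurlVector

/-!
# `Balaban1983to89.B9Eq344HessianSliceTwoBackgroundIdentity` — T. Bałaban, *Propagators for lattice gauge theories in a background field*, Commun. Math. Phys. **99** (1985)
# 389–434 [Balaban1985BackgroundPropagators] Thm 3.1 (3.44) p. 398, (3.23) p. 394, (3.117) p. 419, Thm 3.4 p. 400 with (3.60)–(3.65) pp. 402–403 (*«G′(U) − G′(1) = …»*, the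
# two-background comparison), Thm 3.13 p. 426: **THE RESOLVENT EQUATION OF THE DIFFERENCE OF THE COVARIANT HESSIAN SLICES OF TWO BACKGROUNDS** — for `Δ_{RS}u = ω`
# (background transporters `R, S`, `S_bR_b = 1`) and `Δ_{R₁S₁}u₁ = ω₁` (POINTWISE-TRIVIAL transporters `R₁, S₁`: the flat background read through `Ad(1)`), with the slices
# `w = (D_Ru)(·,μ)`, `w₁ = (D_{R₁}u₁)(·,μ)`, `A_ω(y,κ) = −δ_{κμ}R_{y,μ}ω(y+e_μ)`, `A₁(y,κ) = −δ_{κμ}R₁ω₁(y+e_μ)`: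
# `(Δ_{R₁S₁} + 1)(w − w₁) = D*_{S₁}[(D_{R₁} − D_R)w + (A_ω − A₁)] + [(D*_{S₁} − D*_S)D_Rw + (D*_S − D*_{S₁})A_ω + Comm_μ(u) + (w − w₁)]` — the divergence of η-Hölder data
# plus sup data, EVERY term of which is either a transporter defect (`R − 1`, `S − 1`: small factor `α`), the two-plaquette commutator (small factor `‖J‖ + α`, (3.36)), or a
# genuinely two-background datum (`ω − ω₁`, `w − w₁`).  This is the algebraic step of the two-background (Thm 3.4-type) companion of gen 95's `B9Eq344CovariantHessianRowTower`
# (the one-background Hessian row): the DIFFERENCE of the Hessian slices of `u(U)` and `u(1)` solves a FLAT massive-resolvent equation whose right side the flat (3.44)-letter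
# `B9Eq344ResolventGradientRowTower` and the flat gradient letter `B9Eq342ResolventGradLetterTower` consume (next file `B9Eq344CovariantHessianTwoBackgroundRowTower`).
# NE9 crux-team LEAF PROVER 01, gen 103 (ROUTE (J′): the located letter `H3` of gen 102 — the flat Hessian of `u(U) − u(1)`, `u = G′_kR_kG′_kD*_Uf`).

statement-level skeleton of published theorems with citation tags; proofs where landed; nothing here is a claim about the Yang–Mills mass gap

CITATION HEADER (lean-in-tree rule).  Audit cell `pub-balaban`, sub-cell `t4`, BINDER row NE9; filed by NE9 crux-team LEAF PROVER 01 (`b2b-balaban-t4-ne9-formalise-leaf-01`,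
gen 103; bears_on: R4/N22).  Source READ first-hand (`paper:balaban1985-cmp99-background-propagators`, pp. 394, 398, 400, 402–403, 419, 426).  The CONTENT is [folklore] finite
algebra BY NAME: gen 95's `B9Eq344HessianRowDecomposition.laplace_add_one_hessSlice_eq` at both backgrounds, `B9Eq34CovCurlVector.shift_comm` and
`B9Eq3117CommutatorBound.unshift_shift_comm` (the flat commutator sum vanishes), `B11Eq103H1Complex.covLaplaceSiteK = D* ∘ D`.  Nothing printed is a hypothesis.

WHAT IS PROVED (sorry-free; proof lane — 0 `def`).
* §1 `commSum_eq_zero_of_trivial` — the two-plaquette commutator sum of `B9Eq3117LaplaceDerivCommutator` VANISHES for pointwise-trivial transporters (shifts commute).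
* §2 **`laplace_add_one_hessSlice_sub_eq`** — the displayed identity (the slices, `A_ω`, `A₁`, `Comm_μ(u)` pinned by equations).
HONEST SCOPE.  [folklore] algebra; no estimate; NOT summit progress (cell pub-balaban: NE9 NOT PRINTED ∕ NOT PROVED; «NE9 ⇐ the named binders»; row WALLED ON A MODEL (O-NE9-1;
#5 UNRULED); spine PROVED 0∕9; rung (B)+1 finite T⁴ — NOT infinite volume, NOT mass gap, NOT BetaPertH, NOT Clay).  HONEST DEPENDENCY: continuum YM on T⁴ ⇐ BetaPertH ∧ nine
spine estimates (0/9 proved); BetaPertH ⇐ (D1) ∧ (D4) ∧ CAP+tail; G-an2-4 gates asym, D1 and NE2/3/4.  NEW file; nothing modified.  Net new unproved facts: 0.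
-/


noncomputable section

open scoped BigOperators InnerProductSpace

namespace Literature.MathematicalPhysics.QuantumFieldTheory.Balaban1983to89.B9Eq344HessianSliceTwoBackgroundIdentity

open B4Sect5Torus (TSite)
open B9SectCLatticeCarrier (Bond bpos btgt shift unshift)
open B9Eq311L2Pairing (WL2)
open B11Eq103H1Complex (SiteL2K BondL2K covDerivL2K covDivL2K covLaplaceSiteK)
open B9Eq344HessianRowDecomposition (laplace_add_one_hessSlice_eq)
open B9Eq34CovCurlVector (shift_comm)
open B9Eq3117CommutatorBound (unshift_shift_comm)

/-! ## §1 The commutator sum vanishes for pointwise-trivial transporters -/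

section Identity

variable {d : ℕ} {Pd : Fin d → ℕ} {W : Type*} [NormedAddCommGroup W] [InnerProductSpace ℂ W] [FiniteDimensional ℂ W] {c₀ : ℝ} [Fact (0 < c₀)]

omit [FiniteDimensional ℂ W] in
/-- **The two-plaquette commutator sum of `B9Eq3117LaplaceDerivCommutator` VANISHES for pointwise-trivial transporters** (`R₁(b)w = w`,
`S₁(b)w = w`): shifts commute on the torus. [folklore] [cite: Balaban1985BackgroundPropagators, (3.117) p.419, (3.4) p.391] -/
theorem commSum_eq_zero_of_trivial (c : ℂ) (R₁ S₁ : Bond d Pd → W →ₗ[ℂ] W) (hR₁ : ∀ b w, R₁ b w = w) (hS₁ : ∀ b w, S₁ b w = w)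
    (v : TSite d Pd → W) (μ : Fin d) (x : TSite d Pd) :
    c • (c • (c • ∑ κ,
        ((R₁ (x, μ) (R₁ (shift μ x, κ) (v (shift κ (shift μ x)))) - R₁ (x, κ) (R₁ (shift κ x, μ) (v (shift μ (shift κ x))))) +
         (R₁ (x, μ) (S₁ (unshift κ (shift μ x), κ) (v (unshift κ (shift μ x)))) -
            S₁ (unshift κ x, κ) (R₁ (unshift κ x, μ) (v (shift μ (unshift κ x)))))))) = 0 := by
  have h0 : ∑ κ, ((R₁ (x, μ) (R₁ (shift μ x, κ) (v (shift κ (shift μ x)))) - R₁ (x, κ) (R₁ (shift κ x, μ) (v (shift μ (shift κ x))))) +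
      (R₁ (x, μ) (S₁ (unshift κ (shift μ x), κ) (v (unshift κ (shift μ x)))) -
        S₁ (unshift κ x, κ) (R₁ (unshift κ x, μ) (v (shift μ (unshift κ x)))))) = 0 := by
    refine Finset.sum_eq_zero fun κ _ => ?_
    simp only [hR₁, hS₁]
    rw [shift_comm κ μ x, unshift_shift_comm κ μ x, sub_self, sub_self, add_zero]
  rw [h0, smul_zero, smul_zero, smul_zero]

/-! ## §2 The resolvent equation of the DIFFERENCE of the Hessian slices of two backgrounds -/

omit [FiniteDimensional ℂ W] in
/-- **THE TWO-BACKGROUND SLICE IDENTITY.**  Let `Δ_{RS}u = ω` (background transporters `R`, `S`, `S_bR_b = 1`) and `Δ_{R₁S₁}u₁ = ω₁` with POINTWISE-TRIVIAL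
transporters `R₁`, `S₁` (the flat background read through `Ad(1)`); let `w = (D_Ru)(·,μ)`, `w₁ = (D_{R₁}u₁)(·,μ)` be the Hessian slices, `A_ω(y,κ) = −δ_{κμ}R_{y,μ}ω(y+e_μ)`,
`A₁(y,κ) = −δ_{κμ}R₁ω₁(y+e_μ)` and `Comm_μ(u)` the two-plaquette sum.  Then
`(Δ_{R₁S₁} + 1)(w − w₁) = D*_{S₁}[(D_{R₁} − D_R)w + (A_ω − A₁)] + [(D*_{S₁} − D*_S)D_Rw + (D*_S − D*_{S₁})A_ω + Comm_μ(u) + (w − w₁)]` — the DIVERGENCE of η-Hölder data plus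
sup data, the shape consumed by the flat (3.44)-letter and the flat gradient letter of `(Δ+1)⁻¹`.  Proof: `laplace_add_one_hessSlice_eq` at both backgrounds, the flat commutator sum
vanishes (§1), linear algebra. [folklore] [cite: Balaban1985BackgroundPropagators, (3.23) p.394, (3.117) p.419, Thm 3.1 (3.44) p.398, Thm 3.4 p.400] -/
theorem laplace_add_one_hessSlice_sub_eq (c : ℂ) (R S R₁ S₁ : Bond d Pd → W →ₗ[ℂ] W) (hSR : ∀ b w, S b (R b w) = w)
    (hR₁ : ∀ b w, R₁ b w = w) (hS₁ : ∀ b w, S₁ b w = w)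
    (u ω u₁ ω₁ : SiteL2K ℂ d Pd c₀ W) (hEq : covLaplaceSiteK (c₀ := c₀) c R S u = ω) (hEq₁ : covLaplaceSiteK (c₀ := c₀) c R₁ S₁ u₁ = ω₁) (μ : Fin d)
    (wU w1 CU : SiteL2K ℂ d Pd c₀ W) (AU A1 : BondL2K ℂ d Pd c₀ W)
    (hwU : wU = (WL2.equiv ℂ (fun _ : TSite d Pd => c₀) W).symm fun y => WL2.equiv ℂ (fun _ : Bond d Pd => c₀) W (covDerivL2K ℂ c₀ c R u) (y, μ))
    (hw1 : w1 = (WL2.equiv ℂ (fun _ : TSite d Pd => c₀) W).symm fun y => WL2.equiv ℂ (fun _ : Bond d Pd => c₀) W (covDerivL2K ℂ c₀ c R₁ u₁) (y, μ))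
    (hAU : AU = (WL2.equiv ℂ (fun _ : Bond d Pd => c₀) W).symm fun b =>
          if b.2 = μ then -(R (b.1, μ) (WL2.equiv ℂ (fun _ : TSite d Pd => c₀) W ω (shift μ b.1))) else 0)
    (hA1 : A1 = (WL2.equiv ℂ (fun _ : Bond d Pd => c₀) W).symm fun b =>
          if b.2 = μ then -(R₁ (b.1, μ) (WL2.equiv ℂ (fun _ : TSite d Pd => c₀) W ω₁ (shift μ b.1))) else 0)
    (hCU : CU = (WL2.equiv ℂ (fun _ : TSite d Pd => c₀) W).symm fun x =>
          c • (c • (c • ∑ κ,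
            ((R (x, μ) (R (shift μ x, κ) (WL2.equiv ℂ (fun _ : TSite d Pd => c₀) W u (shift κ (shift μ x)))) -
                R (x, κ) (R (shift κ x, μ) (WL2.equiv ℂ (fun _ : TSite d Pd => c₀) W u (shift μ (shift κ x))))) +
             (R (x, μ) (S (unshift κ (shift μ x), κ) (WL2.equiv ℂ (fun _ : TSite d Pd => c₀) W u (unshift κ (shift μ x)))) -
                S (unshift κ x, κ) (R (unshift κ x, μ) (WL2.equiv ℂ (fun _ : TSite d Pd => c₀) W u (shift μ (unshift κ x))))))))) :
    ((covLaplaceSiteK (c₀ := c₀) c R₁ S₁ + (1 : ℂ) • LinearMap.id : SiteL2K ℂ d Pd c₀ W →ₗ[ℂ] SiteL2K ℂ d Pd c₀ W)) (wU - w1) =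
      covDivL2K ℂ c₀ c S₁ (covDerivL2K ℂ c₀ c R₁ wU - covDerivL2K ℂ c₀ c R wU + (AU - A1)) +
        (covDivL2K ℂ c₀ c S₁ (covDerivL2K ℂ c₀ c R wU) - covDivL2K ℂ c₀ c S (covDerivL2K ℂ c₀ c R wU) +
          (covDivL2K ℂ c₀ c S AU - covDivL2K ℂ c₀ c S₁ AU) + CU + (wU - w1)) := by
  have hS₁R₁ : ∀ b w, S₁ b (R₁ b w) = w := fun b w => by rw [hR₁, hS₁]
  -- the slice equation at `U`
  have hU : covLaplaceSiteK (c₀ := c₀) c R S wU = covDivL2K ℂ c₀ c S AU + CU := by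
    have h := laplace_add_one_hessSlice_eq c R S hSR u ω hEq μ
    rw [← hwU, ← hAU] at h
    have hX : ((WL2.equiv ℂ (fun _ : TSite d Pd => c₀) W).symm fun x =>
          c • (c • (c • ∑ κ,
            ((R (x, μ) (R (shift μ x, κ) (WL2.equiv ℂ (fun _ : TSite d Pd => c₀) W u (shift κ (shift μ x)))) -
                R (x, κ) (R (shift κ x, μ) (WL2.equiv ℂ (fun _ : TSite d Pd => c₀) W u (shift μ (shift κ x))))) +
             (R (x, μ) (S (unshift κ (shift μ x), κ) (WL2.equiv ℂ (fun _ : TSite d Pd => c₀) W u (unshift κ (shift μ x)))) -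
                S (unshift κ x, κ) (R (unshift κ x, μ) (WL2.equiv ℂ (fun _ : TSite d Pd => c₀) W u (shift μ (unshift κ x)))))))) +
          WL2.equiv ℂ (fun _ : Bond d Pd => c₀) W (covDerivL2K ℂ c₀ c R u) (x, μ)) = CU + wU := by
      rw [hCU, hwU]; rfl
    rw [hX, LinearMap.add_apply, LinearMap.smul_apply, LinearMap.id_apply, one_smul, ← add_assoc] at h
    exact add_right_cancel h
  -- the slice equation at the flat background: the commutator sum vanishes
  have h1 : covLaplaceSiteK (c₀ := c₀) c R₁ S₁ w1 = covDivL2K ℂ c₀ c S₁ A1 := by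
    have h := laplace_add_one_hessSlice_eq c R₁ S₁ hS₁R₁ u₁ ω₁ hEq₁ μ
    rw [← hw1, ← hA1] at h
    have hX : ((WL2.equiv ℂ (fun _ : TSite d Pd => c₀) W).symm fun x =>
          c • (c • (c • ∑ κ,
            ((R₁ (x, μ) (R₁ (shift μ x, κ) (WL2.equiv ℂ (fun _ : TSite d Pd => c₀) W u₁ (shift κ (shift μ x)))) -
                R₁ (x, κ) (R₁ (shift κ x, μ) (WL2.equiv ℂ (fun _ : TSite d Pd => c₀) W u₁ (shift μ (shift κ x))))) +
             (R₁ (x, μ) (S₁ (unshift κ (shift μ x), κ) (WL2.equiv ℂ (fun _ : TSite d Pd => c₀) W u₁ (unshift κ (shift μ x)))) -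
                S₁ (unshift κ x, κ) (R₁ (unshift κ x, μ) (WL2.equiv ℂ (fun _ : TSite d Pd => c₀) W u₁ (shift μ (unshift κ x)))))))) +
          WL2.equiv ℂ (fun _ : Bond d Pd => c₀) W (covDerivL2K ℂ c₀ c R₁ u₁) (x, μ)) = w1 := by
      rw [hw1]
      apply (WL2.equiv ℂ (fun _ : TSite d Pd => c₀) W).injective
      funext x
      rw [Equiv.apply_symm_apply, Equiv.apply_symm_apply, commSum_eq_zero_of_trivial c R₁ S₁ hR₁ hS₁, zero_add]
    rw [hX, LinearMap.add_apply, LinearMap.smul_apply, LinearMap.id_apply, one_smul] at h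
    exact add_right_cancel h
  -- linear algebra
  have eU : covLaplaceSiteK (c₀ := c₀) c R S wU = covDivL2K ℂ c₀ c S (covDerivL2K ℂ c₀ c R wU) := rfl
  have e1 : ∀ z, covLaplaceSiteK (c₀ := c₀) c R₁ S₁ z = covDivL2K ℂ c₀ c S₁ (covDerivL2K ℂ c₀ c R₁ z) := fun z => rfl
  rw [LinearMap.add_apply, LinearMap.smul_apply, LinearMap.id_apply, one_smul, map_sub, h1, e1, map_add, map_sub, map_sub]
  rw [eU] at hU
  rw [hU]
  abel

end Identity

end Literature.MathematicalPhysics.QuantumFieldTheory.Balaban1983to89.B9Eq344HessianSliceTwoBackgroundIdentity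

end
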